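import Summits.QuantumFields.BalabanUV.Beta.GAN24.DerivativeRateTransferJensenMassFreeSpread
import Mathlib.Analysis.Matrix.Order

/-!
# `BalabanUV.Beta.GAN24.DerivativeRateTransferJensenMassFreePolarFactor` — binder row G-an2-4 ∕ (CONV-C), route R6 «VALUES, NOT DERIVATIVES», PART 58:
# THE POLAR FACTOR EXISTS — the polar convention of PARTs 51–57 (`hsym`: the mean root-frame defect is symmetric; `hPpsd`: the mean root-frame
# transport is positive semidefinite; `hR′`: the coarse link is orthogonal) is DISCHARGED: for every family of orthogonal open transports whose closed
# loops are within `D < 1` of `1` the weighted mean `M = Σ_x q_x τ_x` is injective, and `R′ := (M·(MᵀM)^{−1∕2})`-style data give an ORTHOGONAL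
# coarse link with `M·R′ᵀ` symmetric positive semidefinite; hence PART 57's `δ = 0` END holds for SOME orthogonal coarse link built from the fine
# field alone (unit b2b-balaban-gan24-p3, gen 44; v1)

NOT IN PRINT; OUR PROOF (for the ROUTE; [folklore] finite-dimensional linear algebra over `ℝ` — the polar decomposition of an invertible real matrix
through Mathlib's continuous-functional-calculus square root `CFC.sqrt` of the positive definite `MᵀM` (`Mathlib.Analysis.Matrix.Order`), Jensen for
convex combinations (PART 57 `dotProduct_self_wsum_le_of_sq_le`), PART 57's END BY NAME).  HONEST FRAMING (cell contract, verbatim): «discharging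
`BetaPertH` makes Bałaban's UV stability UNCONDITIONAL — a real constructive-QFT result; it is NOT the continuum limit and NOT the Clay problem.»
HONEST DEPENDENCY (verbatim): «continuum YM on T⁴ ⇐ BetaPertH ∧ nine spine estimates (0/9 proved); BetaPertH ⇐ (D1) ∧ (D4) ∧ CAP+tail; G-an2-4 gates
asym, D1 and NE2/3/4.»

WHY THIS FILE.  The pricing desk's display for the polar pair's (STAB)^{cov} (PRICING-GAN24 v3.53, R6 (b)) books «the polar factor's existence ∕ PSD
letter `hPpsd` is part of the convention AS DEFINED, not supplied».  In PARTs 51–57 the coarse link `R′_{e′}` is DATA and the polar convention is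
carried by the letters `hR′` (orthogonal), `hsym` (`Σ_x q_x N(e′,x)` symmetric, `N = 1 − τ_xR′ᵀ`) and `hPpsd` (`Σ_x q_x τ_xR′ᵀ ⪰ 0`).  THIS FILE supplies
them: (§1) **`exists_orthogonal_polar`** — every real square matrix `M` with injective `M·` has an ORTHOGONAL `R′` with `M·R′ᵀ` symmetric and positive
semidefinite (`S := MᵀM` is positive definite, `P := S^{1∕2}` (`CFC.sqrt`) is positive semidefinite and invertible with `P² = S`, `R′ := M·P⁻¹`:
`R′ᵀR′ = P⁻¹SP⁻¹ = 1`, `MR′ᵀ = MP⁻¹Mᵀ ⪰ 0`); (§2) **`mulVec_injective_of_loops`** — for weights `q ≥ 0`, `Σq = 1`, orthogonal `τ_x` and closed loops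
`τ_xᵀτ_{x′}` within `D < 1` of `1` the mean `M = Σ_x q_xτ_x` is injective (`τ_{x₀}ᵀM = 1 − Σ_x q_x(1 − τ_{x₀}ᵀτ_x)`, Jensen: `|w| ≤ D|w|` on the kernel);
(§3) **`exists_polarLink`** — in PART 47 ∕ 57's letters (block weights, orthogonal block transporters `W`, chains `T` with their recursion, pairings `σ`)
the loop letter `hloop` with `D < 1` yields coarse links `R′ : β′ → Matrix o o ℝ` satisfying `hR′`, `hsym` (for `N` as DEFINED by `hNdef`) and `hPpsd`;
(§4) **`exists_polarLink_covJensen_massFree`** — hence PART 57's END `covJensen_polar_massFree_of_loops` holds for THESE links: for every coarse form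
dominated by their covariant bond energy, `⟨Qu, H_cQu⟩ ≤ (1 + ε(2D, ϖ, ϖ′; t, r))·⟨u, H_f u⟩`, `δ = 0` — the only letters left about the pair are the
closed-lattice-loop defect `D` (lattice Stokes, LENS ITEM 12 (C)) and the Poincaré data `Φ ∕ ϖ ∕ ϖ′` (PART 49 ∕ 55 for trees).

HONEST SCOPE.  `R′_{e′}` is produced in the full orthogonal group of the colour space `o`; that it lies in the image of the structure group is NOT asserted
here (true for `Ad SU(2) = SO(3)` near `1` and, by `J`-linearity of the functional calculus, for realified `U(N)`; for `SU(N)`, `N ≥ 3`, the unitary polar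
factor carries a `U(1)` phase) — PART 56's transfer `covJensen_transfer_of_polar` is the tool for a second convention within `τ` of this one.  Nothing of
Bałaban's (his `Ū` of [CMP 109] (0.11)–(0.12), the Federbush mean) is instantiated; `D ≤ C·p̂` is NOT proved here.

WHAT THIS FILE PROVES (0 sorry, 0 `def`, nothing cited): §1 `transpose_eq_of_posSemidef`, `posDef_transpose_mul_self_of_injective`,
**`exists_orthogonal_polar`**; §2 `wsum_mul`, **`mulVec_injective_of_loops`**; §3 **`exists_polarLink`**; §4 **`exists_polarLink_covJensen_massFree`**.
WHAT IT DOES NOT DO: bound `D` by the plaquette letter, put `R′` in the structure group, instantiate anything of Bałaban's, or claim (CONS) ∕ exact (STAB).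
SUPPLIER work on route R6 (rank 2, REDUCTION, no seat); no consumer of record; NEVER «G-an2-4 closed»; NOT (CONV-C), NOT D1, NOT `BetaPertH`, NOT
continuum, NOT Clay.  Records: `HOME/b2b-balaban-gan24-p3/WOODBURY-FIBRE.md` v14.4. -/

noncomputable section

open Matrix Finset
open scoped MatrixOrder

namespace Summit.QuantumFields.BalabanUV.Beta.GAN24.DerivativeRateTransferJensenMassFreePolarFactor

open Summit.QuantumFields.BalabanUV.Beta.GAN24.DerivativeRateTransferJensenChain
open Summit.QuantumFields.BalabanUV.Beta.GAN24.DerivativeRateTransferJensenMassFreeEnd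
open Summit.QuantumFields.BalabanUV.Beta.GAN24.DerivativeRateTransferJensenMassFreeSpread

/-! ## §1 The orthogonal polar factor of an injective real matrix -/

section Polar

variable {o : Type*} [Fintype o] [DecidableEq o]

omit [Fintype o] [DecidableEq o] in
/-- a positive semidefinite real matrix is symmetric. [folklore] -/
theorem transpose_eq_of_posSemidef {P : Matrix o o ℝ} (hP : P.PosSemidef) : Pᵀ = P := by
  have h := hP.isHermitian
  rw [IsHermitian, conjTranspose_eq_transpose_of_trivial] at h
  exact h

omit [DecidableEq o] in
/-- `M` injective ⟹ `MᵀM` positive definite (Mathlib's `PosDef.conjTranspose_mul_self` over `ℝ`). [folklore] -/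
theorem posDef_transpose_mul_self_of_injective {M : Matrix o o ℝ} (hM : Function.Injective M.mulVec) : (Mᵀ * M).PosDef := by
  have h := Matrix.PosDef.conjTranspose_mul_self M hM
  simpa only [conjTranspose_eq_transpose_of_trivial] using h

/-- **`exists_orthogonal_polar` — THE ORTHOGONAL POLAR FACTOR EXISTS** [folklore; our proof]: a real square matrix `M` with `M·` injective admits an
ORTHOGONAL `R′` (`R′ᵀR′ = 1`) such that `M·R′ᵀ` is SYMMETRIC and POSITIVE SEMIDEFINITE as a form (`R′ = M·(MᵀM)^{−1∕2}`, `M·R′ᵀ = (MMᵀ)^{1∕2}`). -/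
theorem exists_orthogonal_polar {M : Matrix o o ℝ} (hM : Function.Injective M.mulVec) :
    ∃ R' : Matrix o o ℝ, R'ᵀ * R' = 1 ∧ (M * R'ᵀ)ᵀ = M * R'ᵀ ∧ ∀ w : o → ℝ, 0 ≤ w ⬝ᵥ ((M * R'ᵀ) *ᵥ w) := by
  set S : Matrix o o ℝ := Mᵀ * M with hSdef
  have hS : S.PosDef := posDef_transpose_mul_self_of_injective hM
  set P : Matrix o o ℝ := CFC.sqrt S with hPdef
  have hPP : P * P = S := CFC.sqrt_mul_sqrt_self S hS.posSemidef.nonneg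
  have hPpsd : P.PosSemidef := (CFC.sqrt_nonneg S).posSemidef
  have hPt : Pᵀ = P := transpose_eq_of_posSemidef hPpsd
  have hPunit : IsUnit P := by
    have h : IsUnit (P * P) := by rw [hPP]; exact hS.isUnit
    exact isUnit_mul_self_iff.mp h
  have hPdet : IsUnit P.det := (Matrix.isUnit_iff_isUnit_det P).mp hPunit
  have hinvP : P⁻¹ * P = 1 := Matrix.nonsing_inv_mul P hPdet
  have hPinv : P * P⁻¹ = 1 := Matrix.mul_nonsing_inv P hPdet
  have hPit : (P⁻¹)ᵀ = P⁻¹ := by rw [transpose_nonsing_inv, hPt]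
  have e : (M * P⁻¹)ᵀ = P⁻¹ * Mᵀ := by rw [transpose_mul, hPit]
  refine ⟨M * P⁻¹, ?_, ?_, ?_⟩
  · -- `R′ᵀR′ = P⁻¹·(MᵀM)·P⁻¹ = P⁻¹·P·P·P⁻¹ = 1`
    rw [e]
    calc P⁻¹ * Mᵀ * (M * P⁻¹) = P⁻¹ * (Mᵀ * M) * P⁻¹ := by simp only [Matrix.mul_assoc]
      _ = P⁻¹ * (P * P) * P⁻¹ := by rw [← hSdef, hPP]
      _ = (P⁻¹ * P) * (P * P⁻¹) := by simp only [Matrix.mul_assoc]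
      _ = 1 := by rw [hinvP, hPinv, Matrix.mul_one]
  · -- `M·R′ᵀ = M·P⁻¹·Mᵀ` is symmetric
    rw [e, ← Matrix.mul_assoc, transpose_mul, transpose_mul, transpose_transpose, hPit, Matrix.mul_assoc]
  · -- and positive semidefinite: `⟨w, MP⁻¹Mᵀw⟩ = ⟨Mᵀw, P⁻¹Mᵀw⟩ ≥ 0`
    intro w
    rw [e, ← mulVec_mulVec, ← mulVec_mulVec, dotProduct_mulVec, ← mulVec_transpose]
    have h := hPpsd.inv.dotProduct_mulVec_nonneg (Mᵀ *ᵥ w)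
    simpa only [star_trivial] using h

end Polar

/-! ## §2 The mean open transport is injective when the closed loops are within `D < 1` -/

section Mean

variable {o ν : Type*} [Fintype o] [DecidableEq o] [Fintype ν]

omit [DecidableEq o] in
/-- `(Σ_x q_x•τ_x)·A = Σ_x q_x•(τ_x·A)`. [folklore] -/
theorem wsum_mul (q : ν → ℝ) (τ : ν → Matrix o o ℝ) (A : Matrix o o ℝ) :
    (∑ x, q x • τ x) * A = ∑ x, q x • (τ x * A) := by
  rw [Matrix.sum_mul]
  exact Finset.sum_congr rfl fun x _ => Matrix.smul_mul (q x) (τ x) A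

/-- **`mulVec_injective_of_loops` — THE MEAN TRANSPORT IS INJECTIVE** [our proof]: weights `q ≥ 0` with `Σ_x q_x = 1`, transports `τ_x`, every closed
loop `τ_xᵀτ_{x′}` through sites OF POSITIVE WEIGHT within `D` of `1`, `0 ≤ D < 1` ⟹ `M = Σ_x q_x•τ_x` has injective `M·` (on the kernel,
`w = Σ_x q_x(1 − τ_{x₀}ᵀτ_x)w` for a site `x₀` of positive weight, so `|w|² ≤ D²|w|²` by Jensen over the support). -/
theorem mulVec_injective_of_loops {q : ν → ℝ} (hq : ∀ x, 0 ≤ q x) (hq1 : ∑ x, q x = 1) (τ : ν → Matrix o o ℝ)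
    {D : ℝ} (hD0 : 0 ≤ D) (hD1 : D < 1)
    (hloop : ∀ x x', q x ≠ 0 → q x' ≠ 0 → ∀ w : o → ℝ,
      ((((τ x)ᵀ * τ x') - 1) *ᵥ w) ⬝ᵥ ((((τ x)ᵀ * τ x') - 1) *ᵥ w) ≤ D ^ 2 * (w ⬝ᵥ w)) :
    Function.Injective (∑ x, q x • τ x).mulVec := by
  -- a site of positive weight exists since the weights sum to `1`
  obtain ⟨x₀, -, hx₀⟩ : ∃ x₀ ∈ (Finset.univ : Finset ν), q x₀ ≠ 0 :=
    Finset.exists_ne_zero_of_sum_ne_zero (by rw [hq1]; exact one_ne_zero)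
  set s : Finset ν := Finset.univ.filter fun x => q x ≠ 0 with hsdef
  have hqs1 : ∑ x ∈ s, q x = 1 := by
    refine Eq.trans (Finset.sum_subset (Finset.subset_univ s) fun x _ hxs => ?_) hq1
    by_contra h
    exact hxs (Finset.mem_filter.mpr ⟨Finset.mem_univ _, h⟩)
  set M : Matrix o o ℝ := ∑ x, q x • τ x with hMdef
  -- it suffices that the kernel is trivial
  suffices hker : ∀ w : o → ℝ, M *ᵥ w = 0 → w = 0 by
    intro a b hab
    have h : M *ᵥ (a - b) = 0 := by rw [mulVec_sub]; exact sub_eq_zero.mpr hab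
    exact sub_eq_zero.mp (hker _ h)
  intro w hw
  -- `w = Σ_x q_x•(1 − τ₀ᵀτ_x)w`
  have hMw : ∑ x, q x • (τ x *ᵥ w) = M *ᵥ w := by
    rw [hMdef, Matrix.sum_mulVec]
    exact Finset.sum_congr rfl fun x _ => (smul_mulVec _ _ _).symm
  have hsum : ∑ x, q x • ((1 - (τ x₀)ᵀ * τ x) *ᵥ w) = w := by
    have e : ∀ x, (1 - (τ x₀)ᵀ * τ x) *ᵥ w = w - (τ x₀)ᵀ *ᵥ (τ x *ᵥ w) := fun x => by
      rw [sub_mulVec, one_mulVec, mulVec_mulVec]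
    simp_rw [e, smul_sub]
    rw [Finset.sum_sub_distrib, ← Finset.sum_smul, hq1, one_smul,
      Finset.sum_congr rfl fun x _ => (mulVec_smul ((τ x₀)ᵀ) (q x) (τ x *ᵥ w)).symm, ← Matrix.mulVec_sum, hMw, hw,
      mulVec_zero, sub_zero]
  have hsum' : ∑ x ∈ s, q x • ((1 - (τ x₀)ᵀ * τ x) *ᵥ w) = w := by
    refine Eq.trans (Finset.sum_subset (Finset.subset_univ s) fun x _ hxs => ?_) hsum
    have hqx : q x = 0 := by
      by_contra h
      exact hxs (Finset.mem_filter.mpr ⟨Finset.mem_univ _, h⟩)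
    rw [hqx, zero_smul]
  -- Jensen over the support: `|w|² ≤ D²|w|²`
  have hJ : w ⬝ᵥ w ≤ D ^ 2 * (w ⬝ᵥ w) := by
    have h := dotProduct_self_wsum_le_of_sq_le s (fun x _ => hq x) hqs1.le (fun x => (1 - (τ x₀)ᵀ * τ x) *ᵥ w)
      (mul_nonneg (sq_nonneg D) (dotProduct_self_nonneg' w)) fun x hx => ?_
    · rwa [hsum'] at h
    · have hqx : q x ≠ 0 := (Finset.mem_filter.mp hx).2
      have e : (1 - (τ x₀)ᵀ * τ x) *ᵥ w = -((((τ x₀)ᵀ * τ x) - 1) *ᵥ w) := by rw [← neg_mulVec, neg_sub]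
      rw [e, neg_dotProduct, dotProduct_neg, neg_neg]
      exact hloop x₀ x hx₀ hqx w
  have hD2 : D ^ 2 < 1 := by nlinarith
  have hw0 : w ⬝ᵥ w = 0 := by
    have h0 : 0 ≤ w ⬝ᵥ w := dotProduct_self_nonneg' w
    nlinarith
  exact dotProduct_self_eq_zero.mp hw0

end Mean

/-! ## §3 In PART 47 ∕ 57's letters: coarse links with the three polar letters exist -/

section Link

variable {o μ ν β β' : Type*} [Fintype o] [DecidableEq o] [Fintype μ] [Fintype ν] [Fintype β] [DecidableEq β] [Fintype β']
variable {q : μ → ν → ℝ} {W : μ → ν → Matrix o o ℝ} {Q : Matrix (μ × o) (ν × o) ℝ}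
variable {src tgt : β → ν} {R : β → Matrix o o ℝ} {src' tgt' : β' → μ}
variable {Hf : Matrix (ν × o) (ν × o) ℝ} {wf : ℝ}
variable {σ : β' → ν ≃ ν} {ℓ : ℕ} {xs : β' → ν → ℕ → ν} {γ : β' → ν → ℕ → β} {T : β' → ν → ℕ → Matrix o o ℝ} {m : ℝ}
variable {D : ℝ}

omit [Fintype μ] [Fintype β] [DecidableEq β] [Fintype β'] in
/-- **`exists_polarLink` — THE POLAR LETTERS `hR′`, `hsym`, `hPpsd` ARE INHABITED** [our proof]: block weights `q ≥ 0` with `Σ_x q(y,x) = 1`, ANY block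
transporters `W` and chain transports `T`, pairings `σ`, and the closed-loop letter of PART 57 ON THE SUPPORT OF THE WEIGHTS
`hloop : q(src′e′,x) ≠ 0 → q(src′e′,x′) ≠ 0 → |((W T W′ᵀ)(e′,x)ᵀ·(W T W′ᵀ)(e′,x′) − 1)w|² ≤ D²|w|²` with `0 ≤ D < 1` ⟹ there are coarse links
`R′ : β′ → Matrix o o ℝ` with
(i) `R′_{e′}ᵀR′_{e′} = 1`, (ii) `Σ_x q(src′e′,x)•(1 − W T W′ᵀR′ᵀ)(e′,x)` symmetric, (iii) `Σ_x q(src′e′,x)•(W T W′ᵀR′ᵀ)(e′,x) ⪰ 0` — the polar links of the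
mean open transports. -/
theorem exists_polarLink
    (hq : ∀ y x, 0 ≤ q y x) (hq1 : ∀ y, ∑ x, q y x = 1)
    (hloop : ∀ e' x x', q (src' e') x ≠ 0 → q (src' e') x' ≠ 0 → ∀ w : o → ℝ,
      (((W (src' e') x * T e' x ℓ * (W (tgt' e') (σ e' x))ᵀ)ᵀ * (W (src' e') x' * T e' x' ℓ * (W (tgt' e') (σ e' x'))ᵀ) - 1) *ᵥ w) ⬝ᵥ
          (((W (src' e') x * T e' x ℓ * (W (tgt' e') (σ e' x))ᵀ)ᵀ * (W (src' e') x' * T e' x' ℓ * (W (tgt' e') (σ e' x'))ᵀ) - 1) *ᵥ w) ≤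
        D ^ 2 * (w ⬝ᵥ w))
    (hD0 : 0 ≤ D) (hD1 : D < 1) :
    ∃ R' : β' → Matrix o o ℝ, (∀ e', (R' e')ᵀ * R' e' = 1) ∧
      (∀ e', (∑ x, q (src' e') x • (1 - W (src' e') x * T e' x ℓ * (W (tgt' e') (σ e' x))ᵀ * (R' e')ᵀ))ᵀ =
        ∑ x, q (src' e') x • (1 - W (src' e') x * T e' x ℓ * (W (tgt' e') (σ e' x))ᵀ * (R' e')ᵀ)) ∧
      (∀ e' (w : o → ℝ), 0 ≤ w ⬝ᵥ ((∑ x, q (src' e') x • (W (src' e') x * T e' x ℓ * (W (tgt' e') (σ e' x))ᵀ * (R' e')ᵀ)) *ᵥ w)) := by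
  have h : ∀ e', ∃ R'e : Matrix o o ℝ, R'eᵀ * R'e = 1 ∧
      ((∑ x, q (src' e') x • (W (src' e') x * T e' x ℓ * (W (tgt' e') (σ e' x))ᵀ)) * R'eᵀ)ᵀ =
        (∑ x, q (src' e') x • (W (src' e') x * T e' x ℓ * (W (tgt' e') (σ e' x))ᵀ)) * R'eᵀ ∧
      ∀ w : o → ℝ, 0 ≤ w ⬝ᵥ (((∑ x, q (src' e') x • (W (src' e') x * T e' x ℓ * (W (tgt' e') (σ e' x))ᵀ)) * R'eᵀ) *ᵥ w) := fun e' =>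
    exists_orthogonal_polar (mulVec_injective_of_loops (hq (src' e')) (hq1 (src' e'))
      (fun x => W (src' e') x * T e' x ℓ * (W (tgt' e') (σ e' x))ᵀ) hD0 hD1 (hloop e'))
  choose R' hR'o hR's hR'p using h
  have e3 : ∀ e', ∑ x, q (src' e') x • (W (src' e') x * T e' x ℓ * (W (tgt' e') (σ e' x))ᵀ * (R' e')ᵀ) =
      (∑ x, q (src' e') x • (W (src' e') x * T e' x ℓ * (W (tgt' e') (σ e' x))ᵀ)) * (R' e')ᵀ := fun e' =>
    (wsum_mul (q (src' e')) (fun x => W (src' e') x * T e' x ℓ * (W (tgt' e') (σ e' x))ᵀ) (R' e')ᵀ).symm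
  have e2 : ∀ e', ∑ x, q (src' e') x • (1 - W (src' e') x * T e' x ℓ * (W (tgt' e') (σ e' x))ᵀ * (R' e')ᵀ) =
      1 - (∑ x, q (src' e') x • (W (src' e') x * T e' x ℓ * (W (tgt' e') (σ e' x))ᵀ)) * (R' e')ᵀ := fun e' => by
    rw [← e3 e', Finset.sum_congr rfl fun x _ => smul_sub (q (src' e') x) (1 : Matrix o o ℝ) _, Finset.sum_sub_distrib,
      ← Finset.sum_smul, hq1, one_smul]
  refine ⟨R', hR'o, fun e' => ?_, fun e' w => ?_⟩
  · rw [e2 e', transpose_sub, transpose_one, hR's e']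
  · rw [e3 e']; exact hR'p e' w

end Link

/-! ## §4 PART 57's `δ = 0` END for the polar links -/

section End

variable {o μ ν β β' : Type*} [Fintype o] [DecidableEq o] [Fintype μ] [Fintype ν] [Fintype β] [DecidableEq β] [Fintype β']
variable {q : μ → ν → ℝ} {W : μ → ν → Matrix o o ℝ} {Q : Matrix (μ × o) (ν × o) ℝ}
variable {src tgt : β → ν} {R : β → Matrix o o ℝ} {src' tgt' : β' → μ}
variable {Hf : Matrix (ν × o) (ν × o) ℝ} {wf : ℝ}
variable {σ : β' → ν ≃ ν} {ℓ : ℕ} {xs : β' → ν → ℕ → ν} {γ : β' → ν → ℕ → β} {T : β' → ν → ℕ → Matrix o o ℝ} {m : ℝ}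
variable {D : ℝ}

/-- **`exists_polarLink_covJensen_massFree` — THE MASS-FREE COVARIANT JENSEN INEQUALITY FOR THE POLAR LINKS, CONVENTION LETTERS DISCHARGED**
[our proof; §3 + PART 57 `covJensen_polar_massFree_of_loops`].  Data about the FINE field only: block weights `q ≥ 0`, `Σ_x q(y,x) = 1`, orthogonal
block transporters `W` and fine transporters `R`, the averaging identity `hQ`, a fine form `H_f ≥ w_f·Σ_e|D_eu|²`, pairings `σ` carrying the weights,
straight chains `xs ∕ γ ∕ T` of length `ℓ` with q-weighted multiplicity `≤ m`, and the CLOSED-LOOP letter `hloop` with `0 ≤ D < 1`.  Then THERE ARE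
orthogonal coarse links `R′` (the polar links of §3) such that for every `w_c ≥ 0` with `w_c·ℓ·m ≤ w_f`, every coarse form
`H_c ≤ w_c·Σ_{e′}|R′_{e′}v(tgt′e′) − v(src′e′)|²`, every `u` with Poincaré data `Φ ∕ ϖ ∕ ϖ′`, and all `t, r > 0`:
`⟨Qu, H_cQu⟩ ≤ (1 + t + (1+t⁻¹)(1+r)ϖ(2D)² + (1+t⁻¹)(1+r⁻¹)·3(2D)²(1 + ϖ + ϖ′)∕(4 − (2D)²))·⟨u, H_f u⟩` — `δ = 0`, no convention letter. -/
theorem exists_polarLink_covJensen_massFree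
    (hq : ∀ y x, 0 ≤ q y x) (hq1 : ∀ y, ∑ x, q y x = 1) (hW : ∀ y x, (W y x)ᵀ * W y x = 1) (hR : ∀ e, (R e)ᵀ * R e = 1)
    (hQ : ∀ (u : ν × o → ℝ) (y : μ), (fun a => (Q *ᵥ u) (y, a)) = ∑ x, q y x • (W y x *ᵥ fun b => u (x, b)))
    (hHf : ∀ u : ν × o → ℝ, wf * ∑ e, ((R e *ᵥ fun b => u (tgt e, b)) - fun b => u (src e, b)) ⬝ᵥ
        ((R e *ᵥ fun b => u (tgt e, b)) - fun b => u (src e, b)) ≤ u ⬝ᵥ (Hf *ᵥ u))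
    (hσq : ∀ e' x, q (tgt' e') (σ e' x) = q (src' e') x)
    (hx0 : ∀ e' x, xs e' x 0 = x) (hxℓ : ∀ e' x, xs e' x ℓ = σ e' x)
    (hsrc : ∀ e' x i, i < ℓ → src (γ e' x i) = xs e' x i) (htgt : ∀ e' x i, i < ℓ → tgt (γ e' x i) = xs e' x (i + 1))
    (hT0 : ∀ e' x, T e' x 0 = 1) (hT : ∀ e' x i, i < ℓ → T e' x (i + 1) = T e' x i * R (γ e' x i))
    (hmult : ∀ e, ∑ e', ∑ x, ∑ i ∈ range ℓ, (if γ e' x i = e then q (src' e') x else 0) ≤ m)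
    (hloop : ∀ e' x x' (w : o → ℝ),
      (((W (src' e') x * T e' x ℓ * (W (tgt' e') (σ e' x))ᵀ)ᵀ * (W (src' e') x' * T e' x' ℓ * (W (tgt' e') (σ e' x'))ᵀ) - 1) *ᵥ w) ⬝ᵥ
          (((W (src' e') x * T e' x ℓ * (W (tgt' e') (σ e' x))ᵀ)ᵀ * (W (src' e') x' * T e' x' ℓ * (W (tgt' e') (σ e' x'))ᵀ) - 1) *ᵥ w) ≤
        D ^ 2 * (w ⬝ᵥ w))
    (hD0 : 0 ≤ D) (hD1 : D < 1) :
    ∃ R' : β' → Matrix o o ℝ, (∀ e', (R' e')ᵀ * R' e' = 1) ∧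
      ∀ (wc : ℝ) (_hwc : 0 ≤ wc) (_hw : wc * ℓ * m ≤ wf) (Hc : Matrix (μ × o) (μ × o) ℝ)
        (_hHc : ∀ v : μ × o → ℝ, v ⬝ᵥ (Hc *ᵥ v) ≤
          wc * ∑ e', ((R' e' *ᵥ fun a => v (tgt' e', a)) - fun a => v (src' e', a)) ⬝ᵥ
            ((R' e' *ᵥ fun a => v (tgt' e', a)) - fun a => v (src' e', a)))
        (u : ν × o → ℝ) (Φ : (ν × o → ℝ) → μ → ℝ) (ϖ ϖ' : ℝ)
        (_hP : ∀ y, ∑ x, q y x * (((W y x *ᵥ fun b => u (x, b)) - fun a => (Q *ᵥ u) (y, a)) ⬝ᵥ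
          ((W y x *ᵥ fun b => u (x, b)) - fun a => (Q *ᵥ u) (y, a))) ≤ Φ u y)
        (_hΦ : wc * ∑ e', Φ u (tgt' e') ≤ ϖ * (u ⬝ᵥ (Hf *ᵥ u))) (_hΦ' : wc * ∑ e', Φ u (src' e') ≤ ϖ' * (u ⬝ᵥ (Hf *ᵥ u)))
        (t r : ℝ) (_ht : 0 < t) (_hr : 0 < r),
        (Q *ᵥ u) ⬝ᵥ (Hc *ᵥ (Q *ᵥ u)) ≤
          (1 + t + (1 + t⁻¹) * (1 + r) * ϖ * (2 * D) ^ 2 +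
              (1 + t⁻¹) * (1 + r⁻¹) * (3 * (2 * D) ^ 2 / (4 - (2 * D) ^ 2)) * (1 + ϖ + ϖ')) * (u ⬝ᵥ (Hf *ᵥ u)) := by
  obtain ⟨R', hR'o, hsym, hPpsd⟩ := exists_polarLink (W := W) (T := T) (σ := σ) (src' := src') (tgt' := tgt') (ℓ := ℓ) hq hq1
    (fun e' x x' _ _ w => hloop e' x x' w) hD0 hD1
  refine ⟨R', hR'o, ?_⟩
  intro wc hwc hw Hc hHc u Φ ϖ ϖ' hP hΦ hΦ' t r ht hr
  exact covJensen_polar_massFree_of_loops (N := fun e' x => 1 - W (src' e') x * T e' x ℓ * (W (tgt' e') (σ e' x))ᵀ * (R' e')ᵀ)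
    hq hq1 hW hR hR'o hQ hwc hHc hHf hσq hx0 hxℓ hsrc htgt hT0 hT hmult hw (fun _ _ => rfl) hsym hPpsd hloop hD1 hD0 u hP hΦ hΦ' ht hr

end End

end Summit.QuantumFields.BalabanUV.Beta.GAN24.DerivativeRateTransferJensenMassFreePolarFactor

end
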